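import Summits.BirchSwinnertonDyer.BirchSwinnertonDyer.Theorems.AlignedTransportAtTwoMainConjectureOfRankZeroBSDAtTwoCubicLayerTwoOrderFourRowN3027Certs
import Summits.BirchSwinnertonDyer.BirchSwinnertonDyer.Theorems.AlignedTransportAtTwoMainConjectureOfRankZeroBSDAtTwoCubicElementaryLayerRows
import Summits.BirchSwinnertonDyer.BirchSwinnertonDyer.Theorems.AlignedTransportAtTwoMainConjectureOfRankZeroBSDAtTwoCubicCarrierRoad
import HarnessLib

/-!
# Route `AlignedTransportAtTwo`, crux C2 `MainConjectureOfRankZeroBSDAtTwo` (stmt-BirchSwinnertonDyer-22298):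
# ROW `N = 3027`, PART 3: ★★★ **a class of ORDER `4` in `Cl(K_2)` — hence `rank₂ Cl(K_m) ≤ 2 ∀ m`, `μ₂ = 0`, `λ₂ ≤ 2` — UNCONDITIONALLY, for every cyclotomic
# `ℤ₂`-extension of the cubic `2`-torsion field `ℚ(β)` of `⟨1, 0, 1, -19, 29⟩`** (the first HARD-CORE seed settled in the kernel); `MC₂` at the seed modulo PRINT

HONEST FRAMING (cell `bsd-f1-sign2`, WIDTH-5 attached prover seat `bsd-line-att-p4` gen 41 on line `birth` of the lead `bsd-line-att-p2`;
`--supports` stmt-BirchSwinnertonDyer-22298, closes nothing; BSD is NOT proved by any of this; the crux C2, its verdict «blocked-on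
`Rank1Residual.GreenbergMuConjectureIrreducible`» and every registered stub are untouched).  THEOREMS ONLY (no `def`, no named fact, no instance, no `sorry`).

ASSEMBLY.  Part 1 (identities in `ℤ[θ]`) + part 2 (nine characters, `N·B = 1`) feed this seat's LAYER-TWO ORDER-FOUR DOOR
(`…CubicLayerTwoOrderFourDoor.exists_orderOf_eq_four_layer_two_adjoin_of_towerCert` ∘ `NumberFields.towerCert_of_charMatrix`): the class of `(q₀, s₂ − 5)` has order `4` in
`Cl(K_2)`, `K_2 = ℚ(β)·ℚ(ζ₁₆)⁺`.  Then att-p3 g47's ELEMENTARY-LAYER DOOR row `AlignedTransportAtTwoCubicElementaryLayerRows.classicalMuVanishes_cubicField_n3027_of_orderOf_eq_four` (every other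
input a tree theorem: `h = 1`, `2 ∤ d`, `e₁ = 1`) gives `rank₂ Cl(K_m) ≤ 2 ∀ m`, `μ₂ = 0`, `λ₂ ≤ 2` with NO HYPOTHESIS; and att-p5 g24's carrier road
(`…CubicCarrierRoad.mazurMainConjecture_two_of_muIneqRel_of_classicalMu_cubicField_of_Δ_neg`) gives `MC₂` at the seed modulo PRINT⁵ + MuIneqʳ + `r_an = 0` + analytic `μ₂ = 0` + `BSD₂`
— the class-group datum gone.  CONDITIONAL where marked; BSD is NOT proved; nothing is closed.

References: [Washington1997] §13.3; [NeukirchANT1999] I §3, §7 (7.4), §8; [Cohen1993] §6.5; [Serre1973CourseArithmetic] I §3; [Fukuda1994] Thm. 1; [LMFDB] nf 3.1.3027.1, ec 3027.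
-/

set_option linter.dupNamespace false
set_option autoImplicit false

noncomputable section

open scoped Classical NumberField nonZeroDivisors IntermediateField

namespace Summit.BirchSwinnertonDyer.BirchSwinnertonDyer.Theorems.AlignedTransportAtTwoCubicLayerTwoOrderFourRowN3027

open NumberField IsDedekindDomain Polynomial WeierstrassCurve IntermediateField CongruenceSubgroup Module
  Literature.NumberTheory.IwasawaTheory Literature.NumberTheory.GaloisRepresentations
  Literature.NumberTheory.EllipticCurves Literature.NumberTheory.EllipticCurves.Greenberg1999
  Literature.NumberTheory.EllipticCurves.ModularForms Literature.NumberTheory.EllipticCurves.Rank1Residual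
  Literature.NumberTheory.EllipticCurves.Module
  Literature.NumberTheory.NumberFields Literature.NumberTheory.CubicFields
  Summit.BirchSwinnertonDyer.Rank1Residual Summit.BirchSwinnertonDyer.Rank1Residual.X1.MuLambda
  Summit.BirchSwinnertonDyer.Rank1Residual.X5 Summit.BirchSwinnertonDyer.Rank1Residual.X5.O1
  Summit.BirchSwinnertonDyer.Rank1Residual.X5.Instances Summit.BirchSwinnertonDyer.Rank1Residual.F1Sign2
  Summit.BirchSwinnertonDyer.BirchSwinnertonDyer.Theorems.Rank1ResidualX1Defs
  Summit.BirchSwinnertonDyer.BirchSwinnertonDyer.Theses.AlignedTransportAtTwo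
  Summit.BirchSwinnertonDyer.BirchSwinnertonDyer.Theorems.AlignedTransportAtTwoCubicLayerTwoOrderFourDoor
  Summit.BirchSwinnertonDyer.BirchSwinnertonDyer.Theorems.AlignedTransportAtTwoCubicDoorsDeadSubcellClassNumberD
  Summit.BirchSwinnertonDyer.BirchSwinnertonDyer.Theorems.AlignedTransportAtTwoCubicElementaryLayerRows

/-- ★★★ **A CLASS OF ORDER `4` IN `Cl(K_2)`** for every cyclotomic `ℤ₂`-extension of the cubic `2`-torsion field `ℚ(β)` of `⟨1, 0, 1, -19, 29⟩` (`β` any root):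
the class of `(q₀, s₂ − 5)`, certified by seven units modulo `±` squares, nine residue characters and the ideal identities of part 1 — UNCONDITIONAL.
[cite: NeukirchANT1999, Ch. I §7 Thm. (7.4), Ch. I §3, Ch. I §8] [cite: Cohen1993, §6.5] [cite: Washington1997, §13.1] [cite: LMFDB, number field 3.1.3027.1] -/
theorem exists_orderOf_eq_four_layer_two_cubicField_n3027 {β : AlgebraicClosure ℚ} (hβ : aeval β ((⟨1, 0, 1, -19, 29⟩ : WeierstrassCurve ℤ).baseChange ℚ).twoTorsionPolynomial.toPoly = 0)
    (κP : ZpExtension ↥(IntermediateField.adjoin ℚ ({β} : Set (AlgebraicClosure ℚ))) 2) (hκP : κP.IsCyclotomic) :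
    ∃ c : ClassGroup (𝓞 (κP.layer 2)), orderOf c = 4 := by
  haveI := isElliptic_n3027
  haveI : FiniteDimensional ℚ ↥(IntermediateField.adjoin ℚ ({β} : Set (AlgebraicClosure ℚ))) := IntermediateField.adjoin.finiteDimensional ((AlgebraicClosure.isAlgebraic ℚ).isAlgebraic β).isIntegral
  haveI : NumberField ↥(IntermediateField.adjoin ℚ ({β} : Set (AlgebraicClosure ℚ))) := NumberField.mk
  have hd : ¬ (2 : ℤ) ∣ NumberField.discr ↥(IntermediateField.adjoin ℚ ({β} : Set (AlgebraicClosure ℚ))) := by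
    rw [CubicDisc3027.discr_eq (finrank_cubicField_n3027 hβ) (aeval_theta_n3027 hβ)]; norm_num
  set θI : 𝓞 ↥(IntermediateField.adjoin ℚ ({β} : Set (AlgebraicClosure ℚ))) := MonicCubic.thetaInt (aeval_theta_n3027 hβ) with hθI
  exact AlignedTransportAtTwoCubicLayerTwoOrderFourDoor.exists_orderOf_eq_four_layer_two_adjoin_of_towerCert ((⟨1, 0, 1, -19, 29⟩ : WeierstrassCurve ℤ).baseChange ℚ)
    not_hasRationalTwoTorsionX_n3027 Δ_n3027_neg hβ hd (n := 7) le_rfl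
    ![(1 + 0 * θI + 0 * θI ^ 2), ((-1) + 0 * θI + 0 * θI ^ 2), (1 + 0 * θI + 0 * θI ^ 2), (13 + 14 * θI + 2 * θI ^ 2), (129491 + 27190 * θI + 15770 * θI ^ 2), ((-1388953) + (-290545) * θI + (-168254) * θI ^ 2), ((-465) + (-80) * θI + (-54) * θI ^ 2)]
    ![(1 + 0 * θI + 0 * θI ^ 2), (0 + 0 * θI + 0 * θI ^ 2), (1 + 0 * θI + 0 * θI ^ 2), (19 + (-4) * θI + 2 * θI ^ 2), (91637 + 19242 * θI + 11160 * θI ^ 2), (0 + 0 * θI + 0 * θI ^ 2), (617 + 117 * θI + 73 * θI ^ 2)]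
    ![(0 + 0 * θI + 0 * θI ^ 2), (1 + 0 * θI + 0 * θI ^ 2), (1 + 0 * θI + 0 * θI ^ 2), (0 + 0 * θI + 0 * θI ^ 2), (70146 + 14618 * θI + 8452 * θI ^ 2), (0 + 0 * θI + 0 * θI ^ 2), ((-734) + (-176) * θI + (-92) * θI ^ 2)]
    ![(0 + 0 * θI + 0 * θI ^ 2), (0 + 0 * θI + 0 * θI ^ 2), (0 + 0 * θI + 0 * θI ^ 2), (0 + 0 * θI + 0 * θI ^ 2), (49697 + 10356 * θI + 5988 * θI ^ 2), (0 + 0 * θI + 0 * θI ^ 2), (675 + 157 * θI + 84 * θI ^ 2)]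
    ![((-1) + 0 * θI + 0 * θI ^ 2), ((-1) + 0 * θI + 0 * θI ^ 2), (1 + 0 * θI + 0 * θI ^ 2), ((-13) + (-14) * θI + (-2) * θI ^ 2), ((-129491) + (-27190) * θI + (-15770) * θI ^ 2), (17 + 82 * θI + (-145) * θI ^ 2), ((-76955) + (-16102) * θI + (-9324) * θI ^ 2)]
    ![(1 + 0 * θI + 0 * θI ^ 2), (1 + 0 * θI + 0 * θI ^ 2), (0 + 0 * θI + 0 * θI ^ 2), (19 + (-4) * θI + 2 * θI ^ 2), ((-91637) + (-19242) * θI + (-11160) * θI ^ 2), (0 + 0 * θI + 0 * θI ^ 2), (54423 + 11381 * θI + 6591 * θI ^ 2)]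
    ![(0 + 0 * θI + 0 * θI ^ 2), ((-1) + 0 * θI + 0 * θI ^ 2), (1 + 0 * θI + 0 * θI ^ 2), (0 + 0 * θI + 0 * θI ^ 2), (70146 + 14618 * θI + 8452 * θI ^ 2), (0 + 0 * θI + 0 * θI ^ 2), (100554 + 21032 * θI + 12180 * θI ^ 2)]
    ![(0 + 0 * θI + 0 * θI ^ 2), (1 + 0 * θI + 0 * θI ^ 2), ((-1) + 0 * θI + 0 * θI ^ 2), (0 + 0 * θI + 0 * θI ^ 2), (49697 + 10356 * θI + 5988 * θI ^ 2), (0 + 0 * θI + 0 * θI ^ 2), ((-71101) + (-14875) * θI + (-8614) * θI ^ 2)]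
    (fun i => by fin_cases i <;> [exact hu0_n3027 hβ hθI; exact hu1_n3027 hβ hθI; exact hu2_n3027 hβ hθI; exact hu3_n3027 hβ hθI; exact hu4_n3027 hβ hθI; exact hu5_n3027 hβ hθI; exact hu6_n3027 hβ hθI])
    (hws_n3027 hβ hθI) (hbez_n3027 hβ hθI) (q0_ne_zero_n3027 hβ hθI) (hM2_n3027 hβ hθI) (hV_n3027 hβ hθI) (hM3_n3027 hβ hθI) (hM4_n3027 hβ hθI)
    (towerCert_of_charMatrix _ _ _ _ _ _ _ _ _ _ hNB_n3027 (hchar_n3027 hβ hθI)) κP hκP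

/-- ★★★ **`rank₂ Cl(K_m) ≤ 2 ∀ m`, `μ₂ = 0`, `λ₂ ≤ 2` — UNCONDITIONAL — for every cyclotomic `ℤ₂`-extension of the cubic `2`-torsion field of `⟨1, 0, 1, -19, 29⟩`**
(the HARD-CORE seed `N = 3027`, `t = 3 ∧ e₁ = 1`): att-p3 g47's elementary-layer door row with its displayed input (a class of order `4` in some layer) DISCHARGED at `k = 2`.
[cite: Washington1997, §13.3 Lemmas 13.15, 13.18] [cite: Fukuda1994, Thm. 1, p. 264] [cite: NeukirchANT1999, Ch. I §7 Thm. (7.4)] [cite: LMFDB, number field 3.1.3027.1] -/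
theorem classGroupPRank_le_two_and_mu_lambda_cubicField_n3027 {β : AlgebraicClosure ℚ} (hβ : aeval β ((⟨1, 0, 1, -19, 29⟩ : WeierstrassCurve ℤ).baseChange ℚ).twoTorsionPolynomial.toPoly = 0)
    (κP : ZpExtension ↥(IntermediateField.adjoin ℚ ({β} : Set (AlgebraicClosure ℚ))) 2) (hκP : κP.IsCyclotomic) :
    (∀ m, classGroupPRank κP m ≤ 2) ∧ ClassicalMuVanishes κP ∧ classicalLambda κP ≤ 2 := by
  obtain ⟨c, hc⟩ := exists_orderOf_eq_four_layer_two_cubicField_n3027 hβ κP hκP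
  have h := classicalMuVanishes_cubicField_n3027_of_orderOf_eq_four hβ κP hκP hc
  norm_num at h
  exact h

/-- ★★ **`μ₂(κ) = 0` — UNCONDITIONAL — for every cyclotomic `ℤ₂`-extension `κ` of the cubic field of discriminant `−3027`** (first hard-core seed).
[cite: Washington1997, §13.3] [cite: LMFDB, number field 3.1.3027.1] -/
theorem classicalMuVanishes_cubicField_n3027_unconditional {β : AlgebraicClosure ℚ} (hβ : aeval β ((⟨1, 0, 1, -19, 29⟩ : WeierstrassCurve ℤ).baseChange ℚ).twoTorsionPolynomial.toPoly = 0)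
    (κP : ZpExtension ↥(IntermediateField.adjoin ℚ ({β} : Set (AlgebraicClosure ℚ))) 2) (hκP : κP.IsCyclotomic) : ClassicalMuVanishes κP :=
  (classGroupPRank_le_two_and_mu_lambda_cubicField_n3027 hβ κP hκP).2.1

/-- ★ **`C2` AT THE SEED `⟨1, 0, 1, -19, 29⟩` (`N = 3027`) modulo PRINT⁵ + MuIneqʳ + the crux's own hypotheses at this `W`** — att-p5 g24's carrier road
(`Δ_W < 0`, good ordinary at `2`, no rational `2`-torsion) with its `μ₂ = 0` input DISCHARGED by this row: `MazurMainConjecture W 2` from {`h17` Kato 17.4 at `2`, `hGr` Greenberg 4.1,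
`hper`, `hmod`, `hGZK`} + `hI` = MuIneqʳ (registered stub of line `birth`, verbatim) + `r_an(W) = 0`, analytic `μ₂ = 0` on the even branch, `BSD₂(W)`.  CONDITIONAL; BSD is NOT proved;
nothing is closed. [cite: Kato2004Asterisque, Thm. 17.4 (1)(2) (p. 273)] [cite: GreenbergLNM1716, Thm. 4.1 (p. 102) and Conj. 1.11 (p. 58)] [cite: Iwasawa1973MuInvariants, Thm. 2 and Thm. 3] -/
theorem mazurMainConjecture_two_n3027_of_print
    [((⟨1, 0, 1, -19, 29⟩ : WeierstrassCurve ℤ).baseChange ℚ).IsElliptic] [((⟨1, 0, 1, -19, 29⟩ : WeierstrassCurve ℤ).baseChange ℚ).IsGloballyMinimal]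
    (h17 : ∀ [NeZero (((⟨1, 0, 1, -19, 29⟩ : WeierstrassCurve ℤ).baseChange ℚ).conductorNorm ℤ)] (f : CuspForm (Gamma0 (((⟨1, 0, 1, -19, 29⟩ : WeierstrassCurve ℤ).baseChange ℚ).conductorNorm ℤ)) 2),
      kato_divisibility_allPrimes ((⟨1, 0, 1, -19, 29⟩ : WeierstrassCurve ℤ).baseChange ℚ) 2 (f := f))
    (hGr : Greenberg1999.thm41_charValue_rankZero_anyPrime)
    (hper : realPeriodRat_eq_unit_mul_plusPeriod_two) (hmod : nonempty_modularParametrizationData)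
    (hGZK : rank_eq_analyticRank_of_analyticRank_le_one)
    (hI : ∀ (W : WeierstrassCurve ℚ) [W.IsElliptic] [W.IsGloballyMinimal], IsOrdinaryAt W 2 →
      (∀ x : ℚ, ¬ HasRationalTwoTorsionX W x) →
      ∀ (κ : ZpExtension ℚ 2) (γ : Field.absoluteGaloisGroup ℚ), κ.IsCyclotomic →
      κ.IsTopGenerator γ → IsCyclotomicVariable 2 γ →
      ∀ ⦃N : ℕ⦄ [NeZero N] (f : CuspForm (Gamma0 N) 2), IsNewformOf W f →
      ∀ Gp : IwasawaAlgebra 2, iwasawaToPowerSeries 2 Gp = padicLFunction f (unitRoot W 2 : ℚ_[2]) →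
      ∀ (D : W.SelmerDualData κ γ) (Yr : W.FineSelmerDualDataRelaxedInf κ γ),
        lengthAt (IwasawaAlgebra 2) D.X ⟨IwasawaAlgebra.augIdealP 2, IwasawaAlgebra.isPrime_augIdealP_holds 2⟩ ≤
          lengthAt (IwasawaAlgebra 2) (IwasawaAlgebra 2 ⧸ Ideal.span {Gp})
              ⟨IwasawaAlgebra.augIdealP 2, IwasawaAlgebra.isPrime_augIdealP_holds 2⟩ +
            lengthAt (IwasawaAlgebra 2) Yr.X ⟨IwasawaAlgebra.augIdealP 2, IwasawaAlgebra.isPrime_augIdealP_holds 2⟩)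
    (hr : ((⟨1, 0, 1, -19, 29⟩ : WeierstrassCurve ℤ).baseChange ℚ).analyticRank = 0)
    (hμan : ∀ ⦃N : ℕ⦄ [NeZero N] (f : CuspForm (Gamma0 N) 2), IsNewformOf ((⟨1, 0, 1, -19, 29⟩ : WeierstrassCurve ℤ).baseChange ℚ) f →
      ∀ G : IwasawaAlgebra 2, IsEvenBranchLiftAtTwo ((⟨1, 0, 1, -19, 29⟩ : WeierstrassCurve ℤ).baseChange ℚ) f G → red G ≠ 0)
    (hbsd : BSDp ((⟨1, 0, 1, -19, 29⟩ : WeierstrassCurve ℤ).baseChange ℚ) 2) :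
    MazurMainConjecture ((⟨1, 0, 1, -19, 29⟩ : WeierstrassCurve ℤ).baseChange ℚ) 2 := by
  obtain ⟨β, hβ⟩ := exists_root_twoTorsionPolynomial_n3027
  exact AlignedTransportAtTwoCubicCarrierRoad.mazurMainConjecture_two_of_muIneqRel_of_classicalMu_cubicField_of_Δ_neg ((⟨1, 0, 1, -19, 29⟩ : WeierstrassCurve ℤ).baseChange ℚ)
    h17 hGr hper hmod hGZK hI goodOrd_two_n3027 not_hasRationalTwoTorsionX_n3027 Δ_n3027_neg hr hμan hbsd hβ
    (fun κP hκP => classicalMuVanishes_cubicField_n3027_unconditional hβ κP hκP)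

end Summit.BirchSwinnertonDyer.BirchSwinnertonDyer.Theorems.AlignedTransportAtTwoCubicLayerTwoOrderFourRowN3027

end
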